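import Summits.KontsevichZagierPeriods.KontsevichZagierPeriods.Theses.LiftingCriteria
import Literature.NumberTheory.Transcendental.SemialgebraicLineDeriv
import Literature.NumberTheory.Transcendental.KZSliceFubini

/-!
# Crux `DilationLiftAtOne` (route LiftingCriteria), stub S4: twisted-diagonal integrals

Stub `stub_twistedDiagonal` of the registered line of crux `DilationLiftAtOne`
(stmt-KontsevichZagierPeriods-3571, route LiftingCriteria, problem `KontsevichZagierPeriods`).

For a kernel `K`, `ℚ`-semialgebraic and real-analytic on an open `V ⊆ ℝ^{1+d}` containing every
`vecCons ϖ x` with `ϖ ∈ [0,1]`, `x ∈ [0,1]^d` (that is, containing the closed cube `[0,1]^{1+d}`),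
the *twisted-diagonal integral* `ϖ ↦ ∫_{[0,1]^d} K(ϖ, ϖ y) dy` is ONE dilation function
`ϖ ↦ ∫_{[0,1]^{d+1}} G(ϖ y') dy'` of a Nash cube function `G` on the same `V`, namely
`G = ∂₀(x₀ K) = K + x₀ ∂₀K`:

* `G` is `ℚ`-semialgebraic on `V` (partial derivatives of semialgebraic functions,
  `IsSemialgebraicFunOn.fderiv_apply_single`, and pointwise arithmetic) and analytic on `V`
  (`AnalyticOnNhd.fderiv`);
* for `ϖ ∈ [0,1]` and `y ∈ [0,1]^d`, `t ↦ t K(ϖ t, ϖ y)` has derivative `G(ϖ t, ϖ y)` on `[0,1]`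
  (product and chain rule), so `∫_0^1 G(ϖ • vecCons t y) dt = K(vecCons ϖ (ϖ • y))` (FTC; this is
  uniform in `ϖ`, including `ϖ = 0`);
* Fubini over the first cube coordinate (`(t, y) ↦ vecCons t y` is measure preserving,
  `KZ.measurePreserving_vecCons`) turns `∫_{[0,1]^{d+1}} G(ϖ y') dy'` into the iterated integral.

Pure proof file; no definitions, no named facts. Source: the line skeleton of the crux;
M. Kontsevich, D. Zagier, *Periods* (2001), §1.2.
-/

noncomputable section

open scoped BigOperators
open MeasureTheory Set
open Literature.NumberTheory.Transcendental
open Literature.ModelTheory.ExponentialFields (IsSemialgebraic)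

namespace Summit.KontsevichZagierPeriods.LiftingCriteria.DilationLiftAtOne

variable {d : ℕ}

/-- Scaling by `ϖ ∈ [0,1]` maps the closed unit cube into itself. [folklore] -/
theorem smul_mem_unitCube {n : ℕ} {ϖ : ℝ} (hϖ : ϖ ∈ Set.Icc (0:ℝ) 1) {y : Fin n → ℝ}
    (hy : y ∈ Set.pi Set.univ (fun _ : Fin n => Set.Icc (0:ℝ) 1)) :
    ϖ • y ∈ Set.pi Set.univ (fun _ : Fin n => Set.Icc (0:ℝ) 1) :=
  fun i _ => unitInterval.mul_mem hϖ (hy i (Set.mem_univ i))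

/-- If `V` contains every `vecCons ϖ x` with `ϖ ∈ [0,1]` and `x ∈ [0,1]^d`, then `V` contains the
closed unit cube `[0,1]^{d+1}` (every point is `vecCons` of its head and tail). [folklore] -/
theorem unitCube_subset_of_vecCons_mem {V : Set (Fin (d + 1) → ℝ)}
    (hV : ∀ ϖ ∈ Set.Icc (0:ℝ) 1, ∀ x ∈ Set.pi Set.univ (fun _ : Fin d => Set.Icc (0:ℝ) 1),
      Matrix.vecCons ϖ x ∈ V) :
    Set.pi Set.univ (fun _ : Fin (d + 1) => Set.Icc (0:ℝ) 1) ⊆ V := by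
  intro y' hy'
  have h := hV (Matrix.vecHead y') (hy' 0 (Set.mem_univ _)) (Matrix.vecTail y')
    fun j _ => hy' j.succ (Set.mem_univ _)
  rwa [Matrix.cons_head_tail] at h

/-- `G = K + x₀ ∂₀K` is `ℚ`-semialgebraic on the open set `V` when `K` is `ℚ`-semialgebraic and
analytic there: the partial derivative `∂₀K = fderiv K · e₀` is semialgebraic
(Basu–Pollack–Roy, Prop. 3.22), the coordinate `x₀` is a polynomial, and semialgebraic functions
are closed under pointwise sums and products. [cite: BasuPollackRoy2006, Prop. 3.22] -/
theorem isSemialgebraicFunOn_twist {K G : (Fin (d + 1) → ℝ) → ℝ} {V : Set (Fin (d + 1) → ℝ)}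
    (hVo : IsOpen V) (hK : IsSemialgebraicFunOn ℚ V K) (hKa : AnalyticOnNhd ℝ K V)
    (hG : ∀ x, G x = K x + x 0 * fderiv ℝ K x (Pi.single 0 1)) :
    IsSemialgebraicFunOn ℚ V G := by
  have hVsa : IsSemialgebraic ℚ V := IsSemialgebraicFunOn.isSemialgebraic_holds hK
  have hdK : IsSemialgebraicFunOn ℚ V (fun x => fderiv ℝ K x (Pi.single 0 1)) :=
    IsSemialgebraicFunOn.fderiv_apply_single hVo hK (fun x hx => (hKa x hx).differentiableAt) 0
  have hx0 : IsSemialgebraicFunOn ℚ V (fun x : Fin (d + 1) → ℝ => x 0) :=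
    (isSemialgebraicFunOn_aeval hVsa (MvPolynomial.X 0 : MvPolynomial (Fin (d + 1)) ℚ)).congr
      fun x _ => MvPolynomial.aeval_X x 0
  exact (hK.fun_add (hx0.fun_mul hdK)).congr fun x _ => (hG x).symm

/-- `G = K + x₀ ∂₀K` is real-analytic on `V` when `K` is: the Fréchet derivative of an analytic
function is analytic, and evaluation at a fixed vector, coordinates, products and sums preserve
analyticity. [folklore] -/
theorem analyticOnNhd_twist {K G : (Fin (d + 1) → ℝ) → ℝ} {V : Set (Fin (d + 1) → ℝ)}
    (hKa : AnalyticOnNhd ℝ K V) (hG : ∀ x, G x = K x + x 0 * fderiv ℝ K x (Pi.single 0 1)) :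
    AnalyticOnNhd ℝ G V := by
  have hdK : AnalyticOnNhd ℝ (fun x => fderiv ℝ K x (Pi.single 0 1)) V :=
    (ContinuousLinearMap.apply ℝ ℝ (Pi.single 0 1 : Fin (d + 1) → ℝ)).comp_analyticOnNhd
      hKa.fderiv
  have hx0 : AnalyticOnNhd ℝ (fun x : Fin (d + 1) → ℝ => x 0) V :=
    (ContinuousLinearMap.proj (R := ℝ) (φ := fun _ : Fin (d + 1) => ℝ) 0).analyticOnNhd V
  rw [show G = fun x => K x + x 0 * fderiv ℝ K x (Pi.single 0 1) from funext hG]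
  exact hKa.add (hx0.mul hdK)

/-- **FTC in the first cube variable.** For `ϖ ∈ [0,1]` and `y ∈ [0,1]^d`, with
`G = K + x₀ ∂₀K` and `K` differentiable at the points `vecCons (ϖ t) (ϖ y) ∈ V`, `t ∈ [0,1]`:
`t ↦ t K(ϖ • vecCons t y)` has derivative `G(ϖ • vecCons t y)` (product rule, chain rule along
the affine path `t ↦ ϖ • vecCons t y` with velocity `ϖ e₀`), hence
`∫_{[0,1]} G(ϖ • vecCons t y) dt = K(vecCons ϖ (ϖ • y))`. [folklore] -/
theorem integral_Icc_twist {K G : (Fin (d + 1) → ℝ) → ℝ} {V : Set (Fin (d + 1) → ℝ)}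
    (hV : ∀ ϖ ∈ Set.Icc (0:ℝ) 1, ∀ x ∈ Set.pi Set.univ (fun _ : Fin d => Set.Icc (0:ℝ) 1),
      Matrix.vecCons ϖ x ∈ V)
    (hKa : AnalyticOnNhd ℝ K V) (hG : ∀ x, G x = K x + x 0 * fderiv ℝ K x (Pi.single 0 1))
    (hGc : ContinuousOn G V) {ϖ : ℝ} (hϖ : ϖ ∈ Set.Icc (0:ℝ) 1) {y : Fin d → ℝ}
    (hy : y ∈ Set.pi Set.univ (fun _ : Fin d => Set.Icc (0:ℝ) 1)) :
    ∫ t in Set.Icc (0:ℝ) 1, G (ϖ • Matrix.vecCons t y) = K (Matrix.vecCons ϖ (ϖ • y)) := by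
  -- the path `t ↦ ϖ • vecCons t y` stays in `V` for `t ∈ [0,1]`
  have hmem : ∀ t ∈ Set.Icc (0:ℝ) 1, ϖ • Matrix.vecCons t y ∈ V := by
    intro t ht
    rw [Matrix.smul_cons, smul_eq_mul]
    exact hV _ (unitInterval.mul_mem hϖ ht) _ (smul_mem_unitCube hϖ hy)
  -- its velocity is `ϖ e₀`
  have hγ : ∀ t, HasDerivAt (fun t : ℝ => ϖ • Matrix.vecCons t y)
      (ϖ • (Pi.single 0 1 : Fin (d + 1) → ℝ)) t := by
    intro t
    rw [hasDerivAt_pi]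
    intro i
    refine Fin.cases ?_ (fun j => ?_) i
    · simp only [Pi.smul_apply, Matrix.cons_val_zero, smul_eq_mul, Pi.single_eq_same]
      simpa using (hasDerivAt_id t).const_mul ϖ
    · simp only [Pi.smul_apply, Matrix.cons_val_succ, smul_eq_mul,
        Pi.single_eq_of_ne (Fin.succ_ne_zero j), mul_zero]
      exact hasDerivAt_const t _
  have hcont : Continuous (fun t : ℝ => ϖ • Matrix.vecCons t y) :=
    continuous_iff_continuousAt.2 fun t => (hγ t).continuousAt
  -- `F t = t K(path t)` has derivative `G (path t)` on `[0,1]`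
  have hF : ∀ t ∈ Set.Icc (0:ℝ) 1, HasDerivAt (fun t : ℝ => t * K (ϖ • Matrix.vecCons t y))
      (G (ϖ • Matrix.vecCons t y)) t := by
    intro t ht
    have hKd : HasFDerivAt K (fderiv ℝ K (ϖ • Matrix.vecCons t y)) (ϖ • Matrix.vecCons t y) :=
      (hKa _ (hmem t ht)).differentiableAt.hasFDerivAt
    have hcomp : HasDerivAt (fun t : ℝ => K (ϖ • Matrix.vecCons t y))
        (fderiv ℝ K (ϖ • Matrix.vecCons t y) (ϖ • (Pi.single 0 1 : Fin (d + 1) → ℝ))) t :=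
      hKd.comp_hasDerivAt t (hγ t)
    rw [hG]
    refine ((hasDerivAt_id' t).fun_mul hcomp).congr_deriv ?_
    simp only [map_smul, smul_eq_mul, Pi.smul_apply, Matrix.cons_val_zero]
    ring
  -- FTC
  have hint : IntervalIntegrable (fun t => G (ϖ • Matrix.vecCons t y)) volume 0 1 := by
    refine ContinuousOn.intervalIntegrable ?_
    rw [Set.uIcc_of_le zero_le_one]
    exact hGc.comp hcont.continuousOn hmem
  rw [integral_Icc_eq_integral_Ioc, ← intervalIntegral.integral_of_le zero_le_one,
    intervalIntegral.integral_eq_sub_of_hasDerivAt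
      (fun t ht => hF t (by rwa [Set.uIcc_of_le zero_le_one] at ht)) hint]
  simp

/-- **Fubini over the first cube coordinate.** For `F` integrable on `[0,1]^{d+1}`,
`∫_{[0,1]^{d+1}} F = ∫_{y ∈ [0,1]^d} ∫_{t ∈ [0,1]} F(vecCons t y)`: the map `(t, y) ↦ vecCons t y`
is a measure-preserving measurable embedding `ℝ × ℝ^d → ℝ^{d+1}` pulling the cube back to the
product of cubes, and the product of the restricted measures is the restricted product measure.
[folklore] -/
theorem setIntegral_unitCube_succ (F : (Fin (d + 1) → ℝ) → ℝ)
    (hF : IntegrableOn F (Set.pi Set.univ fun _ : Fin (d + 1) => Set.Icc (0:ℝ) 1) volume) :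
    ∫ y' in Set.pi Set.univ (fun _ : Fin (d + 1) => Set.Icc (0:ℝ) 1), F y' =
      ∫ y in Set.pi Set.univ (fun _ : Fin d => Set.Icc (0:ℝ) 1), ∫ t in Set.Icc (0:ℝ) 1,
        F (Matrix.vecCons t y) := by
  have hpre : (fun p : ℝ × (Fin d → ℝ) => Matrix.vecCons p.1 p.2) ⁻¹'
      (Set.pi Set.univ fun _ : Fin (d + 1) => Set.Icc (0:ℝ) 1) =
      Set.Icc (0:ℝ) 1 ×ˢ Set.pi Set.univ (fun _ : Fin d => Set.Icc (0:ℝ) 1) := by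
    ext p
    simp only [Set.mem_preimage, Set.mem_univ_pi, Fin.forall_fin_succ, Matrix.cons_val_zero,
      Matrix.cons_val_succ, Set.mem_prod]
  have hmp := (KZ.measurePreserving_vecCons (n := d))
  have hint : Integrable (fun p : ℝ × (Fin d → ℝ) => F (Matrix.vecCons p.1 p.2))
      (((volume : Measure ℝ).restrict (Set.Icc (0:ℝ) 1)).prod
        ((volume : Measure (Fin d → ℝ)).restrict
          (Set.pi Set.univ fun _ : Fin d => Set.Icc (0:ℝ) 1))) := by
    have h := (hmp.integrableOn_comp_preimage KZ.measurableEmbedding_vecCons (f := F)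
      (s := Set.pi Set.univ fun _ : Fin (d + 1) => Set.Icc (0:ℝ) 1)).mpr hF
    rw [hpre] at h
    have h' := h.integrable
    rw [← Measure.prod_restrict] at h'
    exact h'
  rw [← hmp.setIntegral_preimage_emb KZ.measurableEmbedding_vecCons F
      (Set.pi Set.univ fun _ : Fin (d + 1) => Set.Icc (0:ℝ) 1), hpre, ← Measure.prod_restrict,
    integral_prod_symm _ hint]

/-- **Stub S4 — twisted-diagonal Nash integrals are single dilation functions.**
For a kernel `K` Nash (`ℚ`-semialgebraic and real-analytic) on an open set `V` containing every
`vecCons ϖ x`, `ϖ ∈ [0,1]`, `x ∈ [0,1]^d`, there is ONE Nash cube function `G` of dimension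
`d + 1` on an open `V' ⊇ [0,1]^{d+1}` with
`∫_{[0,1]^d} K(vecCons ϖ (ϖ • y)) dy = ∫_{[0,1]^{d+1}} G(ϖ • y') dy'` for all `ϖ ∈ [0,1]`.
Witness: `V' = V` and `G = ∂₀(x₀ K) = K + x₀ ∂₀K`; FTC in the first cube variable
(`∫_0^1 G(ϖ • vecCons t y) dt = K(vecCons ϖ (ϖ • y))`, uniformly in `ϖ ∈ [0,1]`) and Fubini
`[0,1]^{d+1} = [0,1] × [0,1]^d`. The device of the item's day-one certificate
(`G(a,b) = ∂_a[a R(a,b)]`). [cite: KontsevichZagier2001, §1.2] -/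
theorem stub_twistedDiagonal :
    ∀ (d : ℕ) (K : (Fin (d + 1) → ℝ) → ℝ) (V : Set (Fin (d + 1) → ℝ)), IsOpen V → (∀ ϖ ∈ Set.Icc (0:ℝ) 1, ∀ x ∈ Set.pi Set.univ (fun _ : Fin d => Set.Icc (0:ℝ) 1), Matrix.vecCons ϖ x ∈ V) → Literature.NumberTheory.Transcendental.IsSemialgebraicFunOn ℚ V K → AnalyticOnNhd ℝ K V → ∃ (G : (Fin (d + 1) → ℝ) → ℝ) (V' : Set (Fin (d + 1) → ℝ)), (IsOpen V' ∧ Set.pi Set.univ (fun _ : Fin (d + 1) => Set.Icc (0:ℝ) 1) ⊆ V' ∧ Literature.NumberTheory.Transcendental.IsSemialgebraicFunOn ℚ V' G ∧ AnalyticOnNhd ℝ G V') ∧ ∀ ϖ ∈ Set.Icc (0:ℝ) 1, (∫ y in Set.pi Set.univ (fun _ : Fin d => Set.Icc (0:ℝ) 1), K (Matrix.vecCons ϖ (ϖ • y))) = ∫ y' in Set.pi Set.univ (fun _ : Fin (d + 1) => Set.Icc (0:ℝ) 1), G (ϖ • y') := by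
  intro d K V hVo hV hK hKa
  -- the witness `G = K + x₀ ∂₀K`, kept opaque through its defining equation `hG`
  obtain ⟨G, hG⟩ : ∃ G : (Fin (d + 1) → ℝ) → ℝ,
      ∀ x, G x = K x + x 0 * fderiv ℝ K x (Pi.single 0 1) := ⟨_, fun _ => rfl⟩
  have hGa : AnalyticOnNhd ℝ G V := analyticOnNhd_twist hKa hG
  have hcube : Set.pi Set.univ (fun _ : Fin (d + 1) => Set.Icc (0:ℝ) 1) ⊆ V :=
    unitCube_subset_of_vecCons_mem hV
  refine ⟨G, V, ⟨hVo, hcube, isSemialgebraicFunOn_twist hVo hK hKa hG, hGa⟩, fun ϖ hϖ => ?_⟩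
  -- `y' ↦ G (ϖ • y')` is continuous, hence integrable, on the compact cube
  have hGc : ContinuousOn (fun y' : Fin (d + 1) → ℝ => G (ϖ • y'))
      (Set.pi Set.univ fun _ : Fin (d + 1) => Set.Icc (0:ℝ) 1) :=
    hGa.continuousOn.comp (continuous_const_smul ϖ).continuousOn
      fun y' hy' => hcube (smul_mem_unitCube hϖ hy')
  have hF : IntegrableOn (fun y' : Fin (d + 1) → ℝ => G (ϖ • y'))
      (Set.pi Set.univ fun _ : Fin (d + 1) => Set.Icc (0:ℝ) 1) volume :=
    ContinuousOn.integrableOn_compact (isCompact_univ_pi fun _ => isCompact_Icc) hGc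
  -- Fubini, then FTC fibrewise
  rw [setIntegral_unitCube_succ _ hF]
  exact setIntegral_congr_fun (MeasurableSet.univ_pi fun _ => measurableSet_Icc)
    fun y hy => (integral_Icc_twist hV hKa hG hGa.continuousOn hϖ hy).symm

end Summit.KontsevichZagierPeriods.LiftingCriteria.DilationLiftAtOne

end
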